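/-
Copyright (c) 2026 the pub-hodgecm-mathlib formalisation cell (harness21).  Prover seat hodgecm-mathlib-LH4-p11 (g11), req620 Track A «(D-RAM) FOUR-FRAME» squad
(STAGE-1b, row (2) of the piece `f_{T₊}`, the (β₂) road (R-36), the K6 road; K6 desk LH4-p16 (g3) WORD #17 A4 «THE INSIDE WINDOW IDENTITY `hin`» — the inside-window half
of `core_holds`, HYPOTHESIS-FIRST on the per-cell laws (A2) and the density (A3)), 2026-09-05.
-/
import Summits.HodgeConjecture.HodgeConjecture.Theorems.F0P3cDyRamCoreOfPerCellLaws         -- ★ p864409 ∕ p864591 (LH4-p16 (g3)): HEAD₃ `coreWindow_of_cellValues_sphere`, §3 `cellValue_of_perCellLaw`; brings ★ DEFS `levelSet`, `levelSetDep`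
import Summits.HodgeConjecture.HodgeConjecture.Theorems.F0P3cDyRamInsideDigitCover          -- ★ (this seat, (P2)): `insideDigit_cover_filter`, `insideDigit_sphereIndex_unique`, `insideDigit_classH_not_classA`; brings ★ p864361, ★ p864480
import Summits.HodgeConjecture.HodgeConjecture.Theorems.F0P3cDyRamWindowLabelSumVanishes    -- ★ p864489 (this seat, K6-(g)): `sum_normSign_affine_filterBall_eq_zero`; brings ★ Lit `normSign_mul_of_fixed`, `normSign_of_not_isNorm`
import HarnessLib

/-!
# Crux `H413`, line LH4 «(D-RAM) FOUR-FRAME» — STAGE-1b, row (2), the (β₂) road (R-36), K6-(e) assembly A4: «THE INSIDE WINDOW IDENTITY» — over the INSIDE cells `i < N` of the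
# live row the two literals' labelled counts agree, `Σ_{i<N} X_H(i) = Σ_{i<min N d} X_A(i)`, from the per-cell laws (A2), ONE density (A3), the digit cover (P2) and the
# vanishing of the label character sum over the fine digit system (K6-(g))

Cell `hodgecm-mathlib` (D-0151), FLOOR 0, crux item H413 = `stmt-HodgeConjecture-24833`, route of record `HCCMUnconditional`; squad F0∕P3c∕LH4; lane
`--supports stmt-HodgeConjecture-24833 --as helper` (count-neutral; pays NO tier-0 row).  THEOREMS ONLY (no `def`, no instance, no notation, no `sorry`, default heartbeats);
★-only imports; states NO law; (β₂) stays a HYPOTHESIS.  HYPOTHESIS-FIRST on A2 (LH4-p15 (g3), `…InsideCellsLawFine`) and A3 (LH4-p18 (g4), the density on `Rd⋆`): their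
conclusions enter as the NAMED letters `hlawH`, `hlawA`, `hdens` in K6 DESK WORD #17's bytes; everything else is ★ and consumed BY NAME.

WHAT (K6 desk LH4-p16 (g3) WORD #17 A4).  Frame: the CORE frame of ★ p864480 (two literals: the hyperbolic line model `(φ, h)` and the anisotropic `(φ′, h′)` of `diagonal dg`, frame
equation with `η ∉ N(E^×)`, `ση = η`), lane B `|α − ρα| = 1`, the INSIDE chart of ★ p864708 (`κ₀ + ρκ₀ = 1`, `Θκ₀ = κ₀`, `|κ₀| = 1`, `ρξ₀ = −ξ₀`, `Θξ₀ = ξ₀`, `|ξ₀| = exp 2(N − 1)`,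
`1 ≤ N`), ONE fine digit system `Rd` (σ-fixed integral representatives modulo `|ϖ|^n`, `2d ≤ n + 3`), the row's affine label `(α₁, γ₁)` in the inside chart (`|α₁| = 1`,
`|γ₁| = |ϖ|^{2·1}`), cells `levelSetDep ρ Θ α (jE ϖ) h_t (b + 2i) b μ` with weights `f_t`, label sets `P_t, Q_t` (abstract, as in ★ HEAD₀), finiteness `hfinLS`, `hfinLS′`;
F1b ★ p864627's literal predicate `LIT_t i V₀ :≡ SPHERE(b + 2i) ∧ CLASS_{h_t}`.  LETTERS: (A2) `hlawH hlawA : ∀ i < N, X_t(i)·#(Rd.filter (LIT_t i)) = n_t(i)·(ω(−h_W^t)·Σ_{V ∈ Rd.filter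
(LIT_t i)} ω(α₁ + γ₁V))` (`h_W^H = 1`, `h_W^A = η`); (A3) `hdens : ∀ i < N, n_H(i) = φ·#(Rd.filter (LIT_H i)) ∧ (i < d → n_A(i) = φ·#(Rd.filter (LIT_A i)))`.  THEN
**`Σ_{i ∈ range N} X_H(i) = Σ_{i ∈ range (min N d)} X_A(i)`** — ★ HEAD₀'s conclusion bytes at `(range N, range (min N d))`, the `hin` letter of ★ p864735
`coreWindow_of_insideWindow_and_topCell`.  MECHANISM: ★ HEAD₃ `coreWindow_of_cellValues_sphere` at `B := Rd`, `S′_t i := Rd.filter (LIT_t i)`, `ω := normSign σ (α₁ + γ₁·)`,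
`c_H := φ·ω(−1)`, `c_A := φ·ω(−η) = −c_H` (`η` non-norm: ★ Lit `normSign_of_not_isNorm`, `normSign_mul_of_fixed`); `hXH hXA` := ★ §3 `cellValue_of_perCellLaw` ∘ (A2, A3);
`hH hA` := `mem_filter`; `hSPH hHA hcov` := ★ (P2); `hω` := ★ K6-(g) §3 at `e = 0, c = 1` (`Rd.filter (|·| ≤ 1) = Rd`).
WHAT IS NOT CLAIMED: (A2) the per-cell laws on `Rd` (LH4-p15), (A3) the density (LH4-p18), the top cell (A5, LH4-p12), `core_holds` (A6, the desk), any census identity.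
HONEST LABEL.  Count-neutral assembly; nothing printed is asserted; no census law is stated; ‹CORE›∕‹CORE-ODD› and (β₂) remain HYPOTHESES; `HC_CM` is proved only modulo the 7
printed citations (2 remaining named inputs: hLiu418 = `stmt-HodgeConjecture-24832`, h413 = `stmt-HodgeConjecture-24833`) until rung 0 closes.
## References
* [Kottwitz1986BaseChangeUnits] R. E. Kottwitz, *Base change for unit elements of Hecke algebras*, Compositio Math. 60 (1986): §1 pp. 240–241 (cell-by-cell lattice bookkeeping).
* [LabesseLanglands1979] J.-P. Labesse, R. P. Langlands, *L-indistinguishability for SL(2)*, Canad. J. Math. 31 (1979): §2 (2.2) p. 9 (κ-signed counts).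
* [Rogawski1990] J. D. Rogawski, *Automorphic Representations of Unitary Groups in Three Variables*, Ann. of Math. Stud. 123 (1990): §4.9 Prop. 4.9.1 (b) p. 55 (the labelled census).
* [Serre1979] J.-P. Serre, *Local Fields*, GTM 67 (1979): Ch. V §3 Prop. 5, Cor. 2–3 pp. 84–86; Ch. XV §2 (norm index two; the conductor).
-/

set_option autoImplicit false

noncomputable section

namespace Summit.HodgeConjecture.HodgeConjecture.Cruxes.H413.F0P3cDyRamInsideWindowIdentity

open scoped Valued WithZero Matrix MatrixGroups Classical
open WithZero Finset
open Literature.NumberTheory.Automorphic Literature.NumberTheory.Automorphic.UnitaryGroup Literature.NumberTheory.Automorphic.UnitaryLatticeTree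
open Literature.NumberTheory.Automorphic.UnitaryThreeFourFrame (IsRamifiedQuadraticDatum normSign normSign_of_not_isNorm)
open Literature.NumberTheory.LocalFields.WildQuadraticDatum (normSign_mul_of_fixed)
open Summit.HodgeConjecture.HodgeConjecture.Cruxes.H413.F0P3cDyRamToricCensusDefs
open Summit.HodgeConjecture.HodgeConjecture.Cruxes.H413.F0P3cDyRamCoreOfPerCellLaws (cellValue_of_perCellLaw coreWindow_of_cellValues_sphere)
open Summit.HodgeConjecture.HodgeConjecture.Cruxes.H413.F0P3cDyRamInsideDigitCover (insideDigit_cover_filter insideDigit_sphereIndex_unique insideDigit_classH_not_classA)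
open Summit.HodgeConjecture.HodgeConjecture.Cruxes.H413.F0P3cDyRamWindowLabelSumVanishes (sum_normSign_affine_filterBall_eq_zero)

variable {E M : Type} [Field E] [Valued E ℤᵐ⁰] [Field M] [Valued M ℤᵐ⁰] {ρ Θ : M →+* M} {α : M}

/-! ## §1 The sign letter of the two literals: `ω(−η) = −ω(−1)` -/

omit [Valued M ℤᵐ⁰] [Field M] in
/-- **THE SIGN LETTER `c_A = −c_H`**: for the frame's non-norm `η` (`ση = η`, `η ∉ N(E^×)`) and any density `φ`: `φ·ω(−η) = −(φ·ω(−1))` (`ω(−η) = ω(−1)·ω(η)`, `ω(η) = −1`).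
(★ HEAD₂∕HEAD₃'s `hc` at `c_H := φ·ω(−h_W^H)`, `c_A := φ·ω(−h_W^A)` with `h_W^H = 1`, `h_W^A = η`.) [cite: Serre1979, Ch. V §3 Prop. 5, Cor. 2–3 pp. 84–86] -/
theorem density_mul_normSign_neg_eta [CompleteSpace E] [Finite 𝓀[E]] {σ : E →+* E} {ϖ : E} {d tE : ℕ} (hD : IsRamifiedQuadraticDatum σ ϖ d tE)
    {η : E} (hησ : σ η = η) (hηN : ¬ ∃ t : E, t * σ t = η) (φ : ℤ) :
    φ * normSign σ (-η) = -(φ * normSign σ (-1)) := by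
  have hη0 : η ≠ 0 := fun h0 => hηN ⟨0, by rw [h0, zero_mul]⟩
  rw [show (-η : E) = -1 * η by ring, normSign_mul_of_fixed hD (by rw [map_neg, map_one]) hησ (by norm_num) hη0, normSign_of_not_isNorm σ hηN]
  ring

/-! ## §2 HEAD — the inside window identity `hin` -/

/-- **HEAD — «THE INSIDE WINDOW IDENTITY» (K6 DESK WORD #17 A4).**  The CORE frame of ★ p864480 + `ση = η`; lane B `|α − ρα| = 1`; the INSIDE chart (`κ₀ + ρκ₀ = 1`, `Θκ₀ = κ₀`,
`|κ₀| = 1`, `ρξ₀ = −ξ₀`, `Θξ₀ = ξ₀`, `|ξ₀| = exp 2(N − 1)`, `1 ≤ N`); cells' letters (`μ`, weights `f f′`, row `b`, label sets `PH QH PA QA`, finiteness); ONE fine digit system `Rd`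
modulo `|ϖ|^n` (`hRd1 hRd2 hRd3`, `2d ≤ n + 3`); the inside label `(α₁, γ₁)` (`σ`-fixed, `|α₁| = 1`, `|γ₁| = |ϖ|^{2·1}`); a density `φ`; the per-cell laws `hlawH hlawA` (A2) and
the density letters `hdens` (A3), all for `i < N`, in F1b's `Rd.filter (LIT_t i)` currency.  THEN
**`Σ_{i ∈ range N} X_H(i) = Σ_{i ∈ range (min N d)} X_A(i)`** (★ HEAD₀'s cell-value bytes at `ϖE := jE ϖ`) — the `hin` letter of ★ `coreWindow_of_insideWindow_and_topCell`.
[cite: Kottwitz1986BaseChangeUnits, §1 pp. 240–241] [cite: LabesseLanglands1979, §2 (2.2) p. 9] [cite: Rogawski1990, §4.9 Prop. 4.9.1 (b) p. 55] [cite: Serre1979, Ch. V §3 Prop. 5, Cor. 2–3 pp. 84–86] -/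
theorem insideWindow_identity [CompleteSpace E] [Finite 𝓀[E]] {σ : E →+* E} {ϖ : E} {d tE : ℕ} (hD : IsRamifiedQuadraticDatum σ ϖ d tE)
    (h2v : Valued.v (2 : E) < 1) (hd : 2 ≤ d)
    (jE : E →+* M) (hjfix : ∀ z, ρ z = z ↔ ∃ c, jE c = z) (hΘj : ∀ c, Θ (jE c) = jE (σ c)) (hjiso : ∀ a, Valued.v (jE a) = Valued.v a)
    (hρρ : ∀ x, ρ (ρ x) = x) (hvρ : ∀ x, Valued.v (ρ x) = Valued.v x) (hΘρ : ∀ x, Θ (ρ x) = ρ (Θ x)) (hU : Valued.v (α - ρ α) = 1)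
    -- the CORE frame: two literals, the frame equation, `η` a fixed non-norm
    (P₁ : GL (Fin 3) E) (dg : Fin 2 → E) (η : E)
    (hA : formCongr σ P₁ ((StdForm.antidiagonal 3).over E) =
      (!![(Matrix.diagonal dg) 0 0, 0, (Matrix.diagonal dg) 0 1; 0, η, 0; (Matrix.diagonal dg) 1 0, 0, (Matrix.diagonal dg) 1 1] : Matrix (Fin 3) (Fin 3) E))
    (hηN : ¬ ∃ t : E, t * σ t = η) (hησ : σ η = η)
    (φ : (Fin 2 → E) →+ M) {h : M} (hform : ∀ x y, jE (pairing σ ((StdForm.antidiagonal 2).over E) x y) = h * Θ (φ x) * φ y + ρ (h * Θ (φ x) * φ y))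
    (hΘh : Θ h = h) (hh : h ≠ 0)
    (φ' : (Fin 2 → E) →+ M) {h' : M} (hform' : ∀ x y, jE (pairing σ (Matrix.diagonal dg) x y) = h' * Θ (φ' x) * φ' y + ρ (h' * Θ (φ' x) * φ' y))
    (hΘh' : Θ h' = h') (hh' : h' ≠ 0)
    -- the inside chart
    {κ₀ ξ₀ : M} (hκ₀ : κ₀ + ρ κ₀ = 1) (hΘκ₀ : Θ κ₀ = κ₀) (hκ₀1 : Valued.v κ₀ = 1) (hξ : ρ ξ₀ = -ξ₀) (hΘξ : Θ ξ₀ = ξ₀)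
    {N : ℕ} (hN : 1 ≤ N) (hξN : Valued.v ξ₀ = exp (2 * ((N : ℤ) - 1)))
    -- the cells' letters
    (μ : M) (f f' : ℕ → ℕ → AddSubgroup M → ℕ) (b : ℕ) (PH QH PA QA : Set (AddSubgroup M))
    (hfinLS : ∀ j a, (levelSet ρ Θ α (jE ϖ) h j a).Finite) (hfinLS' : ∀ j a, (levelSet ρ Θ α (jE ϖ) h' j a).Finite)
    -- the fine digit system and the inside label
    (Rd : Finset E) {n : ℕ} (hRd1 : ∀ V ∈ Rd, σ V = V ∧ Valued.v V ≤ 1)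
    (hRd2 : ∀ V : E, σ V = V → Valued.v V ≤ 1 → ∃ V₀ ∈ Rd, Valued.v (V - V₀) ≤ Valued.v ϖ ^ n)
    (hRd3 : ∀ V ∈ Rd, ∀ V' ∈ Rd, Valued.v (V - V') ≤ Valued.v ϖ ^ n → V = V') (hn : 2 * d ≤ n + 3)
    {α₁ γ₁ : E} (hσα₁ : σ α₁ = α₁) (hα₁ : Valued.v α₁ = 1) (hσγ₁ : σ γ₁ = γ₁) (hγ₁ : Valued.v γ₁ = Valued.v ϖ ^ (2 * 1))
    -- (A2) the per-cell laws on `Rd`, both literals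
    (hlawH : ∀ i, i < N →
      (((∑ᶠ Λ ∈ levelSetDep ρ Θ α (jE ϖ) h (b + 2 * i) b μ ∩ PH, f b (b + 2 * i) Λ : ℕ) : ℤ) -
            ((∑ᶠ Λ ∈ levelSetDep ρ Θ α (jE ϖ) h (b + 2 * i) b μ ∩ QH, f b (b + 2 * i) Λ : ℕ) : ℤ)) *
          ((Rd.filter (fun V₀ : E => Valued.v (κ₀ + jE V₀ * ξ₀) * Valued.v (jE ϖ ^ (b + 2 * i) * (α - ρ α)) = Valued.v (jE ϖ) ^ b ∧
            ∃ e : M, ρ e = e ∧ e * Θ e = (κ₀ + jE V₀ * ξ₀) * ρ (κ₀ + jE V₀ * ξ₀) / (h * ρ h))).card : ℤ) =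
        ((∑ᶠ Λ ∈ levelSetDep ρ Θ α (jE ϖ) h (b + 2 * i) b μ, f b (b + 2 * i) Λ : ℕ) : ℤ) *
          (normSign σ (-1) * ∑ V ∈ Rd.filter (fun V₀ : E => Valued.v (κ₀ + jE V₀ * ξ₀) * Valued.v (jE ϖ ^ (b + 2 * i) * (α - ρ α)) = Valued.v (jE ϖ) ^ b ∧
            ∃ e : M, ρ e = e ∧ e * Θ e = (κ₀ + jE V₀ * ξ₀) * ρ (κ₀ + jE V₀ * ξ₀) / (h * ρ h)), normSign σ (α₁ + γ₁ * V)))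
    (hlawA : ∀ i, i < N →
      (((∑ᶠ Λ ∈ levelSetDep ρ Θ α (jE ϖ) h' (b + 2 * i) b μ ∩ PA, f' b (b + 2 * i) Λ : ℕ) : ℤ) -
            ((∑ᶠ Λ ∈ levelSetDep ρ Θ α (jE ϖ) h' (b + 2 * i) b μ ∩ QA, f' b (b + 2 * i) Λ : ℕ) : ℤ)) *
          ((Rd.filter (fun V₀ : E => Valued.v (κ₀ + jE V₀ * ξ₀) * Valued.v (jE ϖ ^ (b + 2 * i) * (α - ρ α)) = Valued.v (jE ϖ) ^ b ∧
            ∃ e : M, ρ e = e ∧ e * Θ e = (κ₀ + jE V₀ * ξ₀) * ρ (κ₀ + jE V₀ * ξ₀) / (h' * ρ h'))).card : ℤ) =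
        ((∑ᶠ Λ ∈ levelSetDep ρ Θ α (jE ϖ) h' (b + 2 * i) b μ, f' b (b + 2 * i) Λ : ℕ) : ℤ) *
          (normSign σ (-η) * ∑ V ∈ Rd.filter (fun V₀ : E => Valued.v (κ₀ + jE V₀ * ξ₀) * Valued.v (jE ϖ ^ (b + 2 * i) * (α - ρ α)) = Valued.v (jE ϖ) ^ b ∧
            ∃ e : M, ρ e = e ∧ e * Θ e = (κ₀ + jE V₀ * ξ₀) * ρ (κ₀ + jE V₀ * ξ₀) / (h' * ρ h')), normSign σ (α₁ + γ₁ * V)))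
    -- (A3) ONE density for the row and both literals
    (φd : ℤ)
    (hdens : ∀ i, i < N →
      ((∑ᶠ Λ ∈ levelSetDep ρ Θ α (jE ϖ) h (b + 2 * i) b μ, f b (b + 2 * i) Λ : ℕ) : ℤ) =
          φd * ((Rd.filter (fun V₀ : E => Valued.v (κ₀ + jE V₀ * ξ₀) * Valued.v (jE ϖ ^ (b + 2 * i) * (α - ρ α)) = Valued.v (jE ϖ) ^ b ∧
            ∃ e : M, ρ e = e ∧ e * Θ e = (κ₀ + jE V₀ * ξ₀) * ρ (κ₀ + jE V₀ * ξ₀) / (h * ρ h))).card : ℤ) ∧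
        (i < d → ((∑ᶠ Λ ∈ levelSetDep ρ Θ α (jE ϖ) h' (b + 2 * i) b μ, f' b (b + 2 * i) Λ : ℕ) : ℤ) =
          φd * ((Rd.filter (fun V₀ : E => Valued.v (κ₀ + jE V₀ * ξ₀) * Valued.v (jE ϖ ^ (b + 2 * i) * (α - ρ α)) = Valued.v (jE ϖ) ^ b ∧
            ∃ e : M, ρ e = e ∧ e * Θ e = (κ₀ + jE V₀ * ξ₀) * ρ (κ₀ + jE V₀ * ξ₀) / (h' * ρ h'))).card : ℤ))) :
    ∑ i ∈ Finset.range N,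
        (((∑ᶠ Λ ∈ levelSetDep ρ Θ α (jE ϖ) h (b + 2 * i) b μ ∩ PH, f b (b + 2 * i) Λ : ℕ) : ℤ) -
          ((∑ᶠ Λ ∈ levelSetDep ρ Θ α (jE ϖ) h (b + 2 * i) b μ ∩ QH, f b (b + 2 * i) Λ : ℕ) : ℤ)) =
      ∑ i ∈ Finset.range (min N d),
        (((∑ᶠ Λ ∈ levelSetDep ρ Θ α (jE ϖ) h' (b + 2 * i) b μ ∩ PA, f' b (b + 2 * i) Λ : ℕ) : ℤ) -
          ((∑ᶠ Λ ∈ levelSetDep ρ Θ α (jE ϖ) h' (b + 2 * i) b μ ∩ QA, f' b (b + 2 * i) Λ : ℕ) : ℤ)) := by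
  obtain ⟨-, -, hϖ, -, -, -, -⟩ := id hD
  have hRdσ : ∀ V ∈ Rd, σ V = V := fun V hV => (hRd1 V hV).1
  have hRd1' : ∀ V ∈ Rd, Valued.v V ≤ 1 := fun V hV => (hRd1 V hV).2
  -- the sign letter `c_A = −c_H`
  have hc : φd * normSign σ (-η) = -(φd * normSign σ (-1)) := density_mul_normSign_neg_eta hD hησ hηN φd
  -- the label character sums to zero over the whole fine system (★ K6-(g) at `e = 0`, `c = 1`)
  have hω : ∑ V ∈ Rd, normSign σ (α₁ + γ₁ * V) = 0 := by
    have h0 := sum_normSign_affine_filterBall_eq_zero hD h2v hσα₁ hα₁ hσγ₁ (c := 1) (e := 0) hγ₁ (by norm_num) (by omega) (n := n) (by omega)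
      Rd hRd1 hRd2 hRd3 (by omega)
    rwa [Finset.filter_true_of_mem (fun V hV => by rw [mul_zero, pow_zero]; exact hRd1' V hV)] at h0
  refine coreWindow_of_cellValues_sphere ρ Θ α (jE ϖ) h h' μ f f' b PH QH PA QA (Finset.range N) (Finset.range (min N d)) Rd
    (fun i => Rd.filter (fun V₀ : E => Valued.v (κ₀ + jE V₀ * ξ₀) * Valued.v (jE ϖ ^ (b + 2 * i) * (α - ρ α)) = Valued.v (jE ϖ) ^ b ∧
      ∃ e : M, ρ e = e ∧ e * Θ e = (κ₀ + jE V₀ * ξ₀) * ρ (κ₀ + jE V₀ * ξ₀) / (h * ρ h)))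
    (fun i => Rd.filter (fun V₀ : E => Valued.v (κ₀ + jE V₀ * ξ₀) * Valued.v (jE ϖ ^ (b + 2 * i) * (α - ρ α)) = Valued.v (jE ϖ) ^ b ∧
      ∃ e : M, ρ e = e ∧ e * Θ e = (κ₀ + jE V₀ * ξ₀) * ρ (κ₀ + jE V₀ * ξ₀) / (h' * ρ h')))
    (fun V => normSign σ (α₁ + γ₁ * V)) (φd * normSign σ (-1)) (φd * normSign σ (-η)) (fun i hi => ?_) (fun i hi => ?_) hc
    (fun i V => Valued.v (κ₀ + jE V * ξ₀) * Valued.v (jE ϖ ^ (b + 2 * i) * (α - ρ α)) = Valued.v (jE ϖ) ^ b)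
    (fun V => ∃ e : M, ρ e = e ∧ e * Θ e = (κ₀ + jE V * ξ₀) * ρ (κ₀ + jE V * ξ₀) / (h * ρ h))
    (fun V => ∃ e : M, ρ e = e ∧ e * Θ e = (κ₀ + jE V * ξ₀) * ρ (κ₀ + jE V * ξ₀) / (h' * ρ h'))
    (fun i _ V hV => ?_) (fun i _ V hV => ?_)
    (insideDigit_sphereIndex_unique (ρ := ρ) jE hjiso hϖ hU κ₀ ξ₀ b Rd)
    (insideDigit_classH_not_classA hD jE hjfix hΘj hρρ hΘρ P₁ dg η hA hηN φ hform hΘh hh φ' hform' hΘh' hh' hκ₀ hΘκ₀ hξ hΘξ Rd hRdσ)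
    (insideDigit_cover_filter hD jE hjfix hΘj hjiso hρρ hvρ hΘρ hU P₁ dg η hA hηN φ hform hΘh hh φ' hform' hΘh' hh' hκ₀ hΘκ₀ hκ₀1 hξ hΘξ hN hξN b Rd hRdσ hRd1')
    hω
  · -- `hXH`: the H-cell `i < N` — K6-0 law + density ⟹ solved value
    have hiN : i < N := Finset.mem_range.1 hi
    exact cellValue_of_perCellLaw ρ Θ α (jE ϖ) h μ f (b + 2 * i) b PH QH (hfinLS _ _) _ _ (Finset.Subset.refl _) _ (normSign σ (-1)) φd
      (hlawH i hiN) (hdens i hiN).1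
  · -- `hXA`: the A-cell `i < min N d`
    have hi' := Finset.mem_range.1 hi
    have hiN : i < N := lt_of_lt_of_le hi' (min_le_left _ _)
    have hid : i < d := lt_of_lt_of_le hi' (min_le_right _ _)
    exact cellValue_of_perCellLaw ρ Θ α (jE ϖ) h' μ f' (b + 2 * i) b PA QA (hfinLS' _ _) _ _ (Finset.Subset.refl _) _ (normSign σ (-η)) φd
      (hlawA i hiN) ((hdens i hiN).2 hid)
  · obtain ⟨hVR, hsph, hcl⟩ := Finset.mem_filter.1 hV
    exact ⟨hVR, hsph, hcl⟩
  · obtain ⟨hVR, hsph, hcl⟩ := Finset.mem_filter.1 hV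
    exact ⟨hVR, hsph, hcl⟩

end Summit.HodgeConjecture.HodgeConjecture.Cruxes.H413.F0P3cDyRamInsideWindowIdentity

end
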